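import Mathlib
import Summits.Ventures.PercRepro2.Defs
import Summits.Ventures.PercRepro2.Independence
import Summits.Ventures.PercRepro2.Harris
import Summits.Ventures.PercRepro2.CoinDefs
import Summits.Ventures.PercRepro2.CoinArcsOff
import Summits.Ventures.PercRepro2.CoinPendantDefs
import Summits.Ventures.PercRepro2.CoinPendant
import Summits.Ventures.PercRepro2.CoinInduced
import Summits.Ventures.PercRepro2.CoinVdBK
import Summits.Ventures.PercRepro2.CoinBHK
import Summits.Ventures.PercRepro2.CoinReverse
import Summits.Ventures.PercRepro2.CoinLemmaA
import Summits.Ventures.PercRepro2.CoinDarcMixed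
import Summits.Ventures.PercRepro2.CoinTwoPendantDefs
import Summits.Ventures.PercRepro2.CoinTwoPendantMass
import Summits.Ventures.PercRepro2.CoinTraceLevels
import Summits.Ventures.PercRepro2.CoinTraceTower
import Summits.Ventures.PercRepro2.CoinTracePin
import Summits.Ventures.PercRepro2.CoinTraceReduce
import Summits.Ventures.PercRepro2.CoinTraceFn
import Summits.Ventures.PercRepro2.CoinTraceBlock
import Summits.Ventures.PercRepro2.CoinTraceShift
import Summits.Ventures.PercRepro2.CoinTwoStarAbstract

/-!
# Row 2′DARC at the 2-STAR pendant head, on mixed coin systems (blind cell PercRepro2, night-2 g3;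
proofs/NIGHT2-DARC.md §17)

THEOREM `darc_of_twoStar_mixed`: `P = {w, v₁, v₂}` closed out into the single target `t` with
mixed pendant coins; the two leaves are decided by single pendant coins (`v₁ ∈ K⁻ ⟺ c₁` open,
`v₂ ∈ K⁻ ⟺ c₂` open) and the head reaches `t` only through them; `a, b, u ∉ P ∪ {t}`; the
reduced avoidance events non-degenerate.  Then `DARC p arcs s {t} a b u w`.  The 2-star is the
first head whose PIVOTAL family `{{w, v₁}, {w, v₂}, {w, v₁, v₂}}` is not a chain: the proof is the
general reduction `darc_of_trace_functional` (every closed-out head) plus the abstract 2-star lemma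
`twoStar_functional_nonneg` (Abel over the up-sets of the pivotal family, sign blocks from (AV-PA)
and (CU-PA)), whose inputs are produced here: `trace_pa`, `trace_cu_pa` (through `traceFn`),
`shift_avoid_more_C` (decreasing means), `vdBKC` with `A = B = ∅` (increasing pivotal weights),
and the empty level of the phantom trace `{w}`.
-/

namespace Summit.Ventures.PercRepro2.Coin

section Aux

variable {V : Type*} [DecidableEq V]

/-- `Z ∪ T ⊆ gateTarget u w Z T`. -/
lemma subset_gateTarget (u w : V) (Z T : Finset V) : Z ∪ T ⊆ gateTarget u w Z T := by
  unfold gateTarget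
  split_ifs
  · exact Finset.subset_insert _ _
  · exact subset_refl _

/-- `gateTarget` is monotone in the trace. -/
lemma gateTarget_mono (u w : V) {Z Z' : Finset V} (h : Z ⊆ Z') (T : Finset V) :
    gateTarget u w Z T ⊆ gateTarget u w Z' T := by
  unfold gateTarget
  by_cases hw : w ∈ Z
  · rw [if_pos hw, if_pos (h hw)]
    exact Finset.insert_subset_insert _ (Finset.union_subset_union_left h)
  · rw [if_neg hw]
    split_ifs
    · exact (Finset.union_subset_union_left h).trans (Finset.subset_insert _ _)
    · exact Finset.union_subset_union_left h

/-- `gateTarget = Z ∪ T` off the pivotal family. -/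
lemma gateTarget_of_notMem {u w : V} {Z : Finset V} (hw : w ∉ Z) (T : Finset V) :
    gateTarget u w Z T = Z ∪ T := by
  unfold gateTarget
  rw [if_neg hw]

/-- `gateTarget = insert u (Z ∪ T)` on the pivotal family. -/
lemma gateTarget_of_mem {u w : V} {Z : Finset V} (hw : w ∈ Z) (T : Finset V) :
    gateTarget u w Z T = insert u (Z ∪ T) := by
  unfold gateTarget
  rw [if_pos hw]

/-- `insert u (A ∪ T) ∩ (B ∪ T) = A ∪ T` for `A ⊆ B`, `u ∉ B ∪ T`. -/
lemma insert_union_inter_eq {u : V} {A B T : Finset V} (hAB : A ⊆ B) (hu : u ∉ B ∪ T) :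
    insert u (A ∪ T) ∩ (B ∪ T) = A ∪ T := by
  ext x
  simp only [Finset.mem_inter, Finset.mem_insert, Finset.mem_union]
  constructor
  · rintro ⟨h | h, h'⟩
    · subst h
      exact absurd (Finset.mem_union.mpr h') hu
    · exact h
  · intro h
    refine ⟨Or.inr h, ?_⟩
    rcases h with h | h
    · exact Or.inl (hAB h)
    · exact Or.inr h

/-- `insert u (A ∪ T) ∪ (B ∪ T) = insert u (B ∪ T)` for `A ⊆ B`. -/
lemma insert_union_union_eq {u : V} {A B T : Finset V} (hAB : A ⊆ B) :
    insert u (A ∪ T) ∪ (B ∪ T) = insert u (B ∪ T) := by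
  ext x
  simp only [Finset.mem_union, Finset.mem_insert]
  constructor
  · rintro ((h | h | h) | h | h)
    · exact Or.inl h
    · exact Or.inr (Or.inl (hAB h))
    · exact Or.inr (Or.inr h)
    · exact Or.inr (Or.inl h)
    · exact Or.inr (Or.inr h)
  · rintro (h | h | h)
    · exact Or.inl (Or.inl h)
    · exact Or.inr (Or.inl h)
    · exact Or.inl (Or.inr (Or.inr h))

end Aux

section TwoStar

open Classical

variable {V : Type*} {E : Type*} [Fintype V] [DecidableEq V] [Fintype E] [DecidableEq E]
  {R : Type*} [Field R] [LinearOrder R] [IsStrictOrderedRing R]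

/-- The pivotal weights increase along the pivotal family (log-supermodularity of `Z ↦ P(R_Z)`,
`vdBKC` with `A = B = ∅`): for `w ∈ Z ⊆ Z' ⊆ P`, `Q̂_Z · P_{Z'} ≤ P_Z · Q̂_{Z'}`. -/
lemma rho_mono_of_subset (p : E → R) (hp : IsProbVec p) {arcs : E → Finset (V × V)}
    (hS : SameEnds arcs) {P : Finset V} {t : V} (s u w : V) (hu : u ∉ P ∪ {t})
    {Z Z' : Finset V} (hZZ' : Z ⊆ Z') (hZ'P : Z' ⊆ P) (hw : w ∈ Z) :
    prob p (avoidEvent (arcsOff arcs (P ∪ {t})) s (gateTarget u w Z {t})) *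
        prob p (avoidEvent (arcsOff arcs (P ∪ {t})) s (Z' ∪ {t})) ≤
      prob p (avoidEvent (arcsOff arcs (P ∪ {t})) s (gateTarget u w Z' {t})) *
        prob p (avoidEvent (arcsOff arcs (P ∪ {t})) s (Z ∪ {t})) := by
  have hS₀ : SameEnds (arcsOff arcs (P ∪ {t})) := sameEnds_arcsOff hS _
  have h := vdBKC p hp hS₀ s ∅ ∅ (insert u (Z ∪ {t})) (Z' ∪ {t})
  have hu' : u ∉ Z' ∪ {t} := fun h' => hu (Finset.mem_union.mpr (by
    rcases Finset.mem_union.mp h' with h'' | h''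
    · exact Or.inl (hZ'P h'')
    · exact Or.inr h''))
  simp only [connAllC_empty, Set.univ_inter, Finset.empty_union,
    insert_union_inter_eq hZZ' hu', insert_union_union_eq hZZ'] at h
  rw [gateTarget_of_mem hw, gateTarget_of_mem (hZZ' hw)]
  exact h.trans (le_of_eq (mul_comm _ _))


omit [Fintype V] [Fintype E] [DecidableEq E] in
/-- The phantom trace `{w}` has an empty level when `w` reaches `t` only through `v₁` or `v₂`. -/
lemma traceLevel_singleton_head_eq_empty {arcs : E → Finset (V × V)} {w v₁ v₂ t : V}
    (hwv₁ : w ≠ v₁) (hwv₂ : w ≠ v₂)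
    (hwexit : ∀ ω : Config E, ω ∈ bwdEvent arcs w {t} →
      ω ∈ bwdEvent arcs v₁ {t} ∨ ω ∈ bwdEvent arcs v₂ {t}) :
    traceLevel arcs {t} ({w, v₁, v₂} : Finset V) {w} = ∅ := by
  ext ω
  simp only [Set.mem_empty_iff_false, iff_false]
  intro hω
  have hw : ω ∈ bwdEvent arcs w {t} := (hω w (by simp)).mp (Finset.mem_singleton_self w)
  rcases hwexit ω hw with h | h
  · exact hwv₁ ((Finset.mem_singleton.mp ((hω v₁ (by simp)).mpr h))).symm
  · exact hwv₂ ((Finset.mem_singleton.mp ((hω v₂ (by simp)).mpr h))).symm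

/-- **THEOREM (row 2′DARC at the 2-star pendant head, mixed coin systems).** -/
theorem darc_of_twoStar_mixed (p : E → R) (hp : IsProbVec p) {arcs : E → Finset (V × V)}
    (hS : SameEnds arcs) (s a b u w v₁ v₂ t : V) (hwv₁ : w ≠ v₁) (hwv₂ : w ≠ v₂)
    (hv₁₂ : v₁ ≠ v₂) (hclosed : ClosedOut arcs ({w, v₁, v₂} : Finset V) {t}) (hT : TailCoinsIn arcs ({w, v₁, v₂} : Finset V) {t})
    {c₁ c₂ : E} (hc₁ : c₁ ∈ tailCoins arcs ({w, v₁, v₂} : Finset V)) (hleaf₁ : bwdEvent arcs v₁ {t} = openEdge c₁)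
    (hc₂ : c₂ ∈ tailCoins arcs ({w, v₁, v₂} : Finset V)) (hleaf₂ : bwdEvent arcs v₂ {t} = openEdge c₂)
    (hwexit : ∀ ω : Config E, ω ∈ bwdEvent arcs w {t} →
      ω ∈ bwdEvent arcs v₁ {t} ∨ ω ∈ bwdEvent arcs v₂ {t})
    (ha : a ∉ ({w, v₁, v₂} : Finset V) ∪ {t}) (hb : b ∉ ({w, v₁, v₂} : Finset V) ∪ {t}) (hu : u ∉ ({w, v₁, v₂} : Finset V) ∪ {t})
    (hP : ∀ Z ∈ ({w, v₁, v₂} : Finset V).powerset, 0 < prob p (avoidEvent (arcsOff arcs (({w, v₁, v₂} : Finset V) ∪ {t})) s (Z ∪ {t})))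
    (hQ : ∀ Z ∈ ({w, v₁, v₂} : Finset V).powerset,
      0 < prob p (avoidEvent (arcsOff arcs (({w, v₁, v₂} : Finset V) ∪ {t})) s (gateTarget u w Z {t}))) :
    DARC p arcs s {t} a b u w := by
  have hwP : w ∈ ({w, v₁, v₂} : Finset V) := by simp
  have hv₁P : v₁ ∈ ({w, v₁, v₂} : Finset V) := by simp
  have hv₂P : v₂ ∈ ({w, v₁, v₂} : Finset V) := by simp
  have hS₀ : SameEnds (arcsOff arcs (({w, v₁, v₂} : Finset V) ∪ {t})) := sameEnds_arcsOff hS _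
  refine darc_of_trace_functional p hp hS hclosed hT s a b u w hwP ha hb hu hQ ?_
  set D₀ := arcsOff arcs (({w, v₁, v₂} : Finset V) ∪ {t}) with hD₀
  set X₀ : Config E → R := marker D₀ s a with hX₀
  set Y₀ : Config E → R := marker D₀ s b with hY₀
  -- the trace data
  set ℓ : Finset V → R := fun Z => prob p (traceLevel arcs {t} ({w, v₁, v₂} : Finset V) Z) with hℓ
  set Pz : Finset V → R := fun Z => prob p (avoidEvent D₀ s (Z ∪ {t})) with hPz
  set Qz : Finset V → R := fun Z => prob p (avoidEvent D₀ s (gateTarget u w Z {t})) with hQz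
  set Az : Finset V → R := fun Z => massE p X₀ (avoidEvent D₀ s (Z ∪ {t})) with hAz
  set Bz : Finset V → R := fun Z => massE p Y₀ (avoidEvent D₀ s (Z ∪ {t})) with hBz
  set Ahz : Finset V → R := fun Z => massE p X₀ (avoidEvent D₀ s (gateTarget u w Z {t})) with hAhz
  set Bhz : Finset V → R := fun Z => massE p Y₀ (avoidEvent D₀ s (gateTarget u w Z {t})) with hBhz
  have hPpos : ∀ Z : Finset V, Z ⊆ ({w, v₁, v₂} : Finset V) → 0 < Pz Z := fun Z hZ => hP Z (Finset.mem_powerset.mpr hZ)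
  have hQpos : ∀ Z : Finset V, Z ⊆ ({w, v₁, v₂} : Finset V) → 0 < Qz Z := fun Z hZ => hQ Z (Finset.mem_powerset.mpr hZ)
  -- the abstract data
  have hMX : ∑ Z ∈ ({w, v₁, v₂} : Finset V).powerset, Az Z / Pz Z * (ℓ Z * Pz Z) = ∑ Z ∈ ({w, v₁, v₂} : Finset V).powerset, ℓ Z * Az Z := by
    refine Finset.sum_congr rfl fun Z hZ => ?_
    have := (hPpos Z (Finset.mem_powerset.mp hZ)).ne'
    field_simp
  have hMY : ∑ Z ∈ ({w, v₁, v₂} : Finset V).powerset, Bz Z / Pz Z * (ℓ Z * Pz Z) = ∑ Z ∈ ({w, v₁, v₂} : Finset V).powerset, ℓ Z * Bz Z := by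
    refine Finset.sum_congr rfl fun Z hZ => ?_
    have := (hPpos Z (Finset.mem_powerset.mp hZ)).ne'
    field_simp
  have key : ∑ Z ∈ ({w, v₁, v₂} : Finset V).powerset, ℓ Z * Pz Z * (Qz Z / Pz Z) *
        (Ahz Z / Qz Z * (∑ Z' ∈ ({w, v₁, v₂} : Finset V).powerset, ℓ Z' * Pz Z')
          - ∑ Z' ∈ ({w, v₁, v₂} : Finset V).powerset, Az Z' / Pz Z' * (ℓ Z' * Pz Z')) *
        (Bhz Z / Qz Z * (∑ Z' ∈ ({w, v₁, v₂} : Finset V).powerset, ℓ Z' * Pz Z')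
          - ∑ Z' ∈ ({w, v₁, v₂} : Finset V).powerset, Bz Z' / Pz Z' * (ℓ Z' * Pz Z')) =
      ∑ Z ∈ ({w, v₁, v₂} : Finset V).powerset, ℓ Z * Qz Z *
        (Ahz Z / Qz Z * (∑ Z' ∈ ({w, v₁, v₂} : Finset V).powerset, ℓ Z' * Pz Z') - ∑ Z' ∈ ({w, v₁, v₂} : Finset V).powerset, ℓ Z' * Az Z') *
        (Bhz Z / Qz Z * (∑ Z' ∈ ({w, v₁, v₂} : Finset V).powerset, ℓ Z' * Pz Z') - ∑ Z' ∈ ({w, v₁, v₂} : Finset V).powerset, ℓ Z' * Bz Z') := by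
    rw [hMX, hMY]
    refine Finset.sum_congr rfl fun Z hZ => ?_
    have := (hPpos Z (Finset.mem_powerset.mp hZ)).ne'
    field_simp
  rw [← key]
  -- the hypotheses of the abstract lemma
  have hμ : ∀ Z ∈ ({w, v₁, v₂} : Finset V).powerset, 0 ≤ ℓ Z * Pz Z :=
    fun Z _ => mul_nonneg (prob_nonneg hp _) (prob_nonneg hp _)
  have hμw : ℓ {w} * Pz {w} = 0 := by
    have : ℓ {w} = 0 := by
      show prob p (traceLevel arcs {t} ({w, v₁, v₂} : Finset V) {w}) = 0
      rw [traceLevel_singleton_head_eq_empty hwv₁ hwv₂ hwexit, prob_empty]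
    rw [this, zero_mul]
  have hx1 : ∀ Z : Finset V, Z ⊆ ({w, v₁, v₂} : Finset V) → Az Z / Pz Z ≤ 1 := fun Z hZ =>
    (div_le_one₀ (hPpos Z hZ)).mpr (massE_marker_le_prob p hp D₀ s a _)
  have hy1 : ∀ Z : Finset V, Z ⊆ ({w, v₁, v₂} : Finset V) → Bz Z / Pz Z ≤ 1 := fun Z hZ =>
    (div_le_one₀ (hPpos Z hZ)).mpr (massE_marker_le_prob p hp D₀ s b _)
  have hxh1 : ∀ Z : Finset V, Z ⊆ ({w, v₁, v₂} : Finset V) → Ahz Z / Qz Z ≤ 1 := fun Z hZ =>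
    (div_le_one₀ (hQpos Z hZ)).mpr (massE_marker_le_prob p hp D₀ s a _)
  have hyh1 : ∀ Z : Finset V, Z ⊆ ({w, v₁, v₂} : Finset V) → Bhz Z / Qz Z ≤ 1 := fun Z hZ =>
    (div_le_one₀ (hQpos Z hZ)).mpr (massE_marker_le_prob p hp D₀ s b _)
  have hxanti : ∀ Z Z' : Finset V, Z ⊆ Z' → Z' ⊆ ({w, v₁, v₂} : Finset V) → Az Z' / Pz Z' ≤ Az Z / Pz Z :=
    fun Z Z' hZZ' hZ'P => (div_le_div_iff₀ (hPpos Z' hZ'P) (hPpos Z (hZZ'.trans hZ'P))).mpr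
      (shift_avoid_more_C p hp hS₀ s a (Finset.union_subset_union_left hZZ'))
  have hyanti : ∀ Z Z' : Finset V, Z ⊆ Z' → Z' ⊆ ({w, v₁, v₂} : Finset V) → Bz Z' / Pz Z' ≤ Bz Z / Pz Z :=
    fun Z Z' hZZ' hZ'P => (div_le_div_iff₀ (hPpos Z' hZ'P) (hPpos Z (hZZ'.trans hZ'P))).mpr
      (shift_avoid_more_C p hp hS₀ s b (Finset.union_subset_union_left hZZ'))
  have hxhanti : ∀ Z Z' : Finset V, Z ⊆ Z' → Z' ⊆ ({w, v₁, v₂} : Finset V) → Ahz Z' / Qz Z' ≤ Ahz Z / Qz Z :=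
    fun Z Z' hZZ' hZ'P => (div_le_div_iff₀ (hQpos Z' hZ'P) (hQpos Z (hZZ'.trans hZ'P))).mpr
      (shift_avoid_more_C p hp hS₀ s a (gateTarget_mono u w hZZ' {t}))
  have hyhanti : ∀ Z Z' : Finset V, Z ⊆ Z' → Z' ⊆ ({w, v₁, v₂} : Finset V) → Bhz Z' / Qz Z' ≤ Bhz Z / Qz Z :=
    fun Z Z' hZZ' hZ'P => (div_le_div_iff₀ (hQpos Z' hZ'P) (hQpos Z (hZZ'.trans hZ'P))).mpr
      (shift_avoid_more_C p hp hS₀ s b (gateTarget_mono u w hZZ' {t}))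
  have hxh_le : ∀ Z : Finset V, Z ⊆ ({w, v₁, v₂} : Finset V) → Ahz Z / Qz Z ≤ Az Z / Pz Z := fun Z hZ =>
    (div_le_div_iff₀ (hQpos Z hZ) (hPpos Z hZ)).mpr
      (shift_avoid_more_C p hp hS₀ s a (subset_gateTarget u w Z {t}))
  have hyh_le : ∀ Z : Finset V, Z ⊆ ({w, v₁, v₂} : Finset V) → Bhz Z / Qz Z ≤ Bz Z / Pz Z := fun Z hZ =>
    (div_le_div_iff₀ (hQpos Z hZ) (hPpos Z hZ)).mpr
      (shift_avoid_more_C p hp hS₀ s b (subset_gateTarget u w Z {t}))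
  have hxh_eq : ∀ Z : Finset V, Z ⊆ ({w, v₁, v₂} : Finset V) → w ∉ Z → Ahz Z / Qz Z = Az Z / Pz Z := by
    intro Z _ hwZ
    show massE p X₀ (avoidEvent D₀ s (gateTarget u w Z {t})) /
        prob p (avoidEvent D₀ s (gateTarget u w Z {t})) = _
    rw [gateTarget_of_notMem hwZ]
  have hyh_eq : ∀ Z : Finset V, Z ⊆ ({w, v₁, v₂} : Finset V) → w ∉ Z → Bhz Z / Qz Z = Bz Z / Pz Z := by
    intro Z _ hwZ
    show massE p Y₀ (avoidEvent D₀ s (gateTarget u w Z {t})) /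
        prob p (avoidEvent D₀ s (gateTarget u w Z {t})) = _
    rw [gateTarget_of_notMem hwZ]
  have hρ1 : ∀ Z ∈ ({w, v₁, v₂} : Finset V).powerset, w ∉ Z → Qz Z / Pz Z = 1 := by
    intro Z hZ hwZ
    show prob p (avoidEvent D₀ s (gateTarget u w Z {t})) / prob p (avoidEvent D₀ s (Z ∪ {t})) = 1
    rw [gateTarget_of_notMem hwZ]
    exact div_self (hP Z hZ).ne'
  have hρ0 : ∀ Z ∈ ({w, v₁, v₂} : Finset V).powerset, 0 ≤ Qz Z / Pz Z :=
    fun Z _ => div_nonneg (prob_nonneg hp _) (prob_nonneg hp _)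
  have hρle : Qz ({w, v₁, v₂} : Finset V) / Pz ({w, v₁, v₂} : Finset V) ≤ 1 :=
    (div_le_one₀ (hPpos ({w, v₁, v₂} : Finset V) (subset_refl _))).mpr
      (prob_mono hp fun ω hω t' ht' => hω t' (subset_gateTarget u w ({w, v₁, v₂} : Finset V) {t} ht'))
  have hρ₁ : Qz {w, v₁} / Pz {w, v₁} ≤ Qz ({w, v₁, v₂} : Finset V) / Pz ({w, v₁, v₂} : Finset V) :=
    (div_le_div_iff₀ (hPpos _ (by simp [Finset.insert_subset_iff])) (hPpos ({w, v₁, v₂} : Finset V) (subset_refl _))).mpr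
      (rho_mono_of_subset p hp hS s u w hu (by simp [Finset.insert_subset_iff]) (subset_refl _)
        (by simp))
  have hρ₂ : Qz {w, v₂} / Pz {w, v₂} ≤ Qz ({w, v₁, v₂} : Finset V) / Pz ({w, v₁, v₂} : Finset V) :=
    (div_le_div_iff₀ (hPpos _ (by simp [Finset.insert_subset_iff])) (hPpos ({w, v₁, v₂} : Finset V) (subset_refl _))).mpr
      (rho_mono_of_subset p hp hS s u w hu (by simp [Finset.insert_subset_iff]) (subset_refl _)
        (by simp))
  -- the two positive-association inputs
  have hPA : TracePA ({w, v₁, v₂} : Finset V) (fun Z => ℓ Z * Pz Z) := by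
    intro U hU f₁ f₂ h₁ h₂ h₁0 h₂0
    have h := trace_pa p hp hS hclosed hT hU s (monotone_traceFn ({w, v₁, v₂} : Finset V) h₁) (monotone_traceFn ({w, v₁, v₂} : Finset V) h₂)
      (traceFn_nonneg ({w, v₁, v₂} : Finset V) h₁0) (traceFn_nonneg ({w, v₁, v₂} : Finset V) h₂0)
    have e₁ : ∑ Z ∈ ({w, v₁, v₂} : Finset V).powerset.filter (fun Z => Disjoint Z U),
        traceFn ({w, v₁, v₂} : Finset V) f₁ ↑Z * (ℓ Z * Pz Z) =
        ∑ Z ∈ ({w, v₁, v₂} : Finset V).powerset.filter (fun Z => Disjoint Z U), f₁ Z * (ℓ Z * Pz Z) :=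
      Finset.sum_congr rfl fun Z hZ => by
        rw [traceFn_coe ({w, v₁, v₂} : Finset V) f₁ (Finset.mem_powerset.mp (Finset.mem_filter.mp hZ).1)]
    have e₂ : ∑ Z ∈ ({w, v₁, v₂} : Finset V).powerset.filter (fun Z => Disjoint Z U),
        traceFn ({w, v₁, v₂} : Finset V) f₂ ↑Z * (ℓ Z * Pz Z) =
        ∑ Z ∈ ({w, v₁, v₂} : Finset V).powerset.filter (fun Z => Disjoint Z U), f₂ Z * (ℓ Z * Pz Z) :=
      Finset.sum_congr rfl fun Z hZ => by
        rw [traceFn_coe ({w, v₁, v₂} : Finset V) f₂ (Finset.mem_powerset.mp (Finset.mem_filter.mp hZ).1)]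
    have e₁₂ : ∑ Z ∈ ({w, v₁, v₂} : Finset V).powerset.filter (fun Z => Disjoint Z U),
        traceFn ({w, v₁, v₂} : Finset V) f₁ ↑Z * traceFn ({w, v₁, v₂} : Finset V) f₂ ↑Z * (ℓ Z * Pz Z) =
        ∑ Z ∈ ({w, v₁, v₂} : Finset V).powerset.filter (fun Z => Disjoint Z U), f₁ Z * f₂ Z * (ℓ Z * Pz Z) :=
      Finset.sum_congr rfl fun Z hZ => by
        rw [traceFn_coe ({w, v₁, v₂} : Finset V) f₁ (Finset.mem_powerset.mp (Finset.mem_filter.mp hZ).1),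
          traceFn_coe ({w, v₁, v₂} : Finset V) f₂ (Finset.mem_powerset.mp (Finset.mem_filter.mp hZ).1)]
    rw [e₁, e₂, e₁₂] at h
    exact h
  have hCU : ∀ v : V, v ∈ ({w, v₁, v₂} : Finset V) → ∀ c : E, c ∈ tailCoins arcs ({w, v₁, v₂} : Finset V) →
      bwdEvent arcs v {t} = openEdge c → TraceCUPA ({w, v₁, v₂} : Finset V) (fun Z => ℓ Z * Pz Z) v := by
    intro v hv c hc hleaf f₁ f₂ h₁ h₂ h₁0 h₂0
    have h := trace_cu_pa p hp hS hclosed hT hv hc hleaf s (monotone_traceFn ({w, v₁, v₂} : Finset V) h₁)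
      (monotone_traceFn ({w, v₁, v₂} : Finset V) h₂) (traceFn_nonneg ({w, v₁, v₂} : Finset V) h₁0) (traceFn_nonneg ({w, v₁, v₂} : Finset V) h₂0)
    have e₁ : ∑ Z ∈ ({w, v₁, v₂} : Finset V).powerset.filter (fun Z => v ∈ Z), traceFn ({w, v₁, v₂} : Finset V) f₁ ↑Z * (ℓ Z * Pz Z) =
        ∑ Z ∈ ({w, v₁, v₂} : Finset V).powerset.filter (fun Z => v ∈ Z), f₁ Z * (ℓ Z * Pz Z) :=
      Finset.sum_congr rfl fun Z hZ => by
        rw [traceFn_coe ({w, v₁, v₂} : Finset V) f₁ (Finset.mem_powerset.mp (Finset.mem_filter.mp hZ).1)]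
    have e₂ : ∑ Z ∈ ({w, v₁, v₂} : Finset V).powerset.filter (fun Z => v ∈ Z), traceFn ({w, v₁, v₂} : Finset V) f₂ ↑Z * (ℓ Z * Pz Z) =
        ∑ Z ∈ ({w, v₁, v₂} : Finset V).powerset.filter (fun Z => v ∈ Z), f₂ Z * (ℓ Z * Pz Z) :=
      Finset.sum_congr rfl fun Z hZ => by
        rw [traceFn_coe ({w, v₁, v₂} : Finset V) f₂ (Finset.mem_powerset.mp (Finset.mem_filter.mp hZ).1)]
    have e₁₂ : ∑ Z ∈ ({w, v₁, v₂} : Finset V).powerset.filter (fun Z => v ∈ Z),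
        traceFn ({w, v₁, v₂} : Finset V) f₁ ↑Z * traceFn ({w, v₁, v₂} : Finset V) f₂ ↑Z * (ℓ Z * Pz Z) =
        ∑ Z ∈ ({w, v₁, v₂} : Finset V).powerset.filter (fun Z => v ∈ Z), f₁ Z * f₂ Z * (ℓ Z * Pz Z) :=
      Finset.sum_congr rfl fun Z hZ => by
        rw [traceFn_coe ({w, v₁, v₂} : Finset V) f₁ (Finset.mem_powerset.mp (Finset.mem_filter.mp hZ).1),
          traceFn_coe ({w, v₁, v₂} : Finset V) f₂ (Finset.mem_powerset.mp (Finset.mem_filter.mp hZ).1)]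
    rw [e₁, e₂, e₁₂] at h
    exact h
  exact twoStar_functional_nonneg hwv₁ hwv₂ hv₁₂ (fun Z => ℓ Z * Pz Z) (fun Z => Az Z / Pz Z)
    (fun Z => Bz Z / Pz Z) (fun Z => Ahz Z / Qz Z) (fun Z => Bhz Z / Qz Z) (fun Z => Qz Z / Pz Z)
    hμ hμw hx1 hy1 hxh1 hyh1 hxanti hyanti hxhanti hyhanti hxh_le hyh_le hxh_eq hyh_eq hρ1 hρ0
    hρle hρ₁ hρ₂ hPA (hCU v₁ hv₁P c₁ hc₁ hleaf₁) (hCU v₂ hv₂P c₂ hc₂ hleaf₂)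

end TwoStar

end Summit.Ventures.PercRepro2.Coin
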